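import Mathlib
import Summits.HodgeConjecture.FermatCycles.HodgeFermatCoincEnumA
import Summits.HodgeConjecture.FermatCycles.HodgeFermatChiThreeB

/-!
# THEOREM U⁼ with its exceptions LISTED — part 2: multiset form, the listed coincidences, `ThmUList` (`HodgeFermat/CoincEnum.lean`; HF-G27d)

Tree copy (part 2 of 2) of the module `HodgeFermat/CoincEnum.lean` of the sibling cell's standalone package
`run/shared/lean/pub/pub-hodgefermat/lean/HodgeFermat/` (393 lines, sha256 `74a5988e69624d45…`), source lines 257–393 (§3 the multiset form `coincidences_21`/`coincidences_39`, §4 the listed coincidences are real and distinct, §5 `ThmUList`).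
Filed by cell `pub-hfermat`, seat prover-1 gen-3, on the COORDINATOR KEEPER RULING of 2026-08-25 (gem sweep H1: take the
off-gate kernel theorem `thmFstar` through the gate) — here THEOREM F* of `tables/DPRIME-THEOREM.md` §9 IN FULL, i.e.
PROPOSITION D′(3N) and the descent (`HodgeFermat/PropDPrimeNFinal.lean`, GATE HF-G34), the last off-gate form of THEOREM F*
(its first two forms, `DecodingFinal.thmFstar` = F* at the prime levels and `ThmFstarNFinal.thmFstar` = F*(3N), landed on
2026-08-25 as `HodgeFermatThmFstar.lean` / `HodgeFermatThmFstarN.lean`, seats prover-1 gen-0 / gen-2); this file is one link of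
the import closure of `PropDPrimeNFinal.propDprime` (the sibling's KR-free chain: THEOREM L, COROLLARY M, THEOREM D6,
THEOREM U⁺, THEOREM KR6, THEOREM Z3U) on top of those landed chains.  The source module is the sibling's hub-checked module of
record (pub-hodgefermat `CERT.md` l.921, GATE HF-G27d); its declarations are copied VERBATIM.
Deviations from the source module, exhaustively: the `import` lines (tree modules `Summits.HodgeConjecture.FermatCycles.
HodgeFermat*` instead of `HodgeFermat.*`); this module docstring; the `set_option`/namespace/`open` preamble (source l.30–34) is repeated at the top because the module is split; DEDUP (pre-empting the gate's `dedup.landed`): the source's `lemma inH_mod` (l.315–317) and `lemma sameType_of_fin` (l.319–325) restate the landed `HodgeFermat.KRFree.ChiThree.inH_mod` / `sameType_of_fin` (`HodgeFermatChiThreeB.lean`) VERBATIM and are DELETED, re-bound by the added line `export HodgeFermat.KRFree.ChiThree (inH_mod sameType_of_fin)` (extra import; `export` so that `CoincEnum.sameType_of_fin`, used downstream through `open HodgeFermat.KRFree.CoincEnum`, remains available as an alias) so that the use sites (source l.329, 334, 338, 342) stay byte-identical; one-line docstrings added (gate lint) to `sameType_39₄`, `sameType_39₈`, `shapes_distinct_39`.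 The module docstring is quoted in full in part 1.
Every other line — in particular every declaration's statement and proof — is byte-identical to the source.
HONEST FRAMING: explicit algebraic cycles for specific Hodge classes on Fermat/Delsarte varieties; residual open instances
listed; no claim on general Hodge.  (This file is arithmetic of CM types / finite combinatorics / analytic number theory
of the sibling's KR-free programme; it claims nothing about cycles.)
-/

set_option autoImplicit false

namespace HodgeFermat.KRFree.CoincEnum

open HodgeFermat.KRFree.LemmaN HodgeFermat.KRFree.TheoremUEq

export HodgeFermat.KRFree.ChiThree (inH_mod sameType_of_fin)

/-! ## The two exceptional levels, as multisets in `ℤ/21` and `ℤ/39` -/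

/-- a residue triple of shape `t·(q₁, q₂, q₃)` is the multiset `{q₁ t, q₂ t, q₃ t}` in `ℤ/N` -/
lemma zmod_multiset_pat {N a b c t q₁ q₂ q₃ : ℕ}
    (h : Perm3 (a % N) (b % N) (c % N) (t * q₁ % N) (t * q₂ % N) (t * q₃ % N)) :
    ({(a : ZMod N), (b : ZMod N), (c : ZMod N)} : Multiset (ZMod N)) =
      {(q₁ : ZMod N) * (t : ZMod N), (q₂ : ZMod N) * (t : ZMod N), (q₃ : ZMod N) * (t : ZMod N)} := by
  rw [zmod_multiset_eq h]
  push_cast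
  simp only [mul_comm]

/-- **The all-unit coincidences at `21`.**  Two all-unit zero-sum triples mod `21` with the same CM type are
permutations of each other, or — for some `t ∈ ℤ/21` — `{a, b, c} = {t, 4t, 16t}` and `{a', b', c'} = {2t, 8t, 11t}`
(the class of `(1, 4, 16) ∼ (2, 8, 11)`, `tables/SEMI-THEOREM.md` §4.2). -/
theorem coincidences_21 (a b c a' b' c' : ℕ) (hs : 21 ∣ a + b + c) (hs' : 21 ∣ a' + b' + c')
    (ha : Nat.Coprime a 21) (hb : Nat.Coprime b 21) (hc : Nat.Coprime c 21)
    (ha' : Nat.Coprime a' 21) (hb' : Nat.Coprime b' 21) (hc' : Nat.Coprime c' 21)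
    (hT : SameType 21 (a, b, c) (a', b', c')) :
    ({(a : ZMod 21), (b : ZMod 21), (c : ZMod 21)} : Multiset (ZMod 21)) =
        {(a' : ZMod 21), (b' : ZMod 21), (c' : ZMod 21)} ∨
      ∃ t : ZMod 21, ({(a : ZMod 21), (b : ZMod 21), (c : ZMod 21)} : Multiset (ZMod 21)) = {t, 4 * t, 16 * t} ∧
        ({(a' : ZMod 21), (b' : ZMod 21), (c' : ZMod 21)} : Multiset (ZMod 21)) = {2 * t, 8 * t, 11 * t} := by
  rcases coincAt_21 a b c a' b' c' hs hs' ha hb hc ha' hb' hc' hT with h | ⟨t, -, -, p, hp, hP, hP'⟩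
  · exact Or.inl (zmod_multiset_eq h)
  · right
    have hp1 : p = (1, 4, 16, 2, 8, 11) := by simpa [pats21] using hp
    subst hp1
    refine ⟨(t : ZMod 21), ?_, ?_⟩
    · simpa using zmod_multiset_pat hP
    · simpa using zmod_multiset_pat hP'

/-- **The all-unit coincidences at `39`.**  Two all-unit zero-sum triples mod `39` with the same CM type are
permutations of each other, or — for some `t ∈ ℤ/39` — `{a, b, c} = {t, 16t, 22t}` and `{a', b', c'}` is one of
`{2t, 32t, 5t}`, `{4t, 25t, 10t}`, `{8t, 11t, 20t}` (the class `{(1,16,22), (2,5,32), (4,10,25), (8,11,20)}`, §4.2). -/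
theorem coincidences_39 (a b c a' b' c' : ℕ) (hs : 39 ∣ a + b + c) (hs' : 39 ∣ a' + b' + c')
    (ha : Nat.Coprime a 39) (hb : Nat.Coprime b 39) (hc : Nat.Coprime c 39)
    (ha' : Nat.Coprime a' 39) (hb' : Nat.Coprime b' 39) (hc' : Nat.Coprime c' 39)
    (hT : SameType 39 (a, b, c) (a', b', c')) :
    ({(a : ZMod 39), (b : ZMod 39), (c : ZMod 39)} : Multiset (ZMod 39)) =
        {(a' : ZMod 39), (b' : ZMod 39), (c' : ZMod 39)} ∨
      ∃ t : ZMod 39, ({(a : ZMod 39), (b : ZMod 39), (c : ZMod 39)} : Multiset (ZMod 39)) = {t, 16 * t, 22 * t} ∧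
        (({(a' : ZMod 39), (b' : ZMod 39), (c' : ZMod 39)} : Multiset (ZMod 39)) = {2 * t, 32 * t, 5 * t} ∨
          ({(a' : ZMod 39), (b' : ZMod 39), (c' : ZMod 39)} : Multiset (ZMod 39)) = {4 * t, 25 * t, 10 * t} ∨
          ({(a' : ZMod 39), (b' : ZMod 39), (c' : ZMod 39)} : Multiset (ZMod 39)) = {8 * t, 11 * t, 20 * t}) := by
  rcases coincAt_39 a b c a' b' c' hs hs' ha hb hc ha' hb' hc' hT with h | ⟨t, -, -, p, hp, hP, hP'⟩
  · exact Or.inl (zmod_multiset_eq h)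
  · right
    have hp3 : p = (1, 16, 22, 2, 32, 5) ∨ p = (1, 16, 22, 4, 25, 10) ∨ p = (1, 16, 22, 8, 11, 20) := by
      simpa [pats39] using hp
    refine ⟨(t : ZMod 39), ?_, ?_⟩
    · rcases hp3 with rfl | rfl | rfl <;> simpa using zmod_multiset_pat hP
    · rcases hp3 with rfl | rfl | rfl
      · exact Or.inl (by simpa using zmod_multiset_pat hP')
      · exact Or.inr (Or.inl (by simpa using zmod_multiset_pat hP'))
      · exact Or.inr (Or.inr (by simpa using zmod_multiset_pat hP'))

/-! ## The listed shapes ARE coincidences -/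

/-- `t·(1, 4, 16) ∼ t·(2, 8, 11)` at `21` for every unit `t` -/
theorem sameType_21 (t : ℕ) (ht : Nat.Coprime t 21) :
    SameType 21 (t * 1, t * 4, t * 16) (t * 2, t * 8, t * 11) :=
  sameType_scale ht (sameType_of_fin (by norm_num) (by decide))

/-- `t·(1, 16, 22) ∼ t·(2, 32, 5)`, `t·(4, 25, 10)`, `t·(8, 11, 20)` at `39` for every unit `t` -/
theorem sameType_39₂ (t : ℕ) (ht : Nat.Coprime t 39) :
    SameType 39 (t * 1, t * 16, t * 22) (t * 2, t * 32, t * 5) :=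
  sameType_scale ht (sameType_of_fin (by norm_num) (by decide))

/-- the listed coincidence `t·(1, 16, 22) ∼ t·(4, 25, 10)` at level 39 -/
theorem sameType_39₄ (t : ℕ) (ht : Nat.Coprime t 39) :
    SameType 39 (t * 1, t * 16, t * 22) (t * 4, t * 25, t * 10) :=
  sameType_scale ht (sameType_of_fin (by norm_num) (by decide))

/-- the listed coincidence `t·(1, 16, 22) ∼ t·(8, 11, 20)` at level 39 -/
theorem sameType_39₈ (t : ℕ) (ht : Nat.Coprime t 39) :
    SameType 39 (t * 1, t * 16, t * 22) (t * 8, t * 11, t * 20) :=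
  sameType_scale ht (sameType_of_fin (by norm_num) (by decide))

/-- for every unit `t` the two shapes at `21` are NOT permutations of each other (the coincidences are genuine) -/
theorem shapes_distinct_21 : ((unitList 21).all fun t =>
    !(perm3B (t * 1 % 21) (t * 4 % 21) (t * 16 % 21) (t * 2 % 21) (t * 8 % 21) (t * 11 % 21))) = true := by
  decide +kernel

/-- the three shapes at level 39 are pairwise non-permutations for every unit `t` (kernel) -/
theorem shapes_distinct_39 : ((unitList 39).all fun t =>
    !(perm3B (t * 1 % 39) (t * 16 % 39) (t * 22 % 39) (t * 2 % 39) (t * 32 % 39) (t * 5 % 39)) &&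
    !(perm3B (t * 1 % 39) (t * 16 % 39) (t * 22 % 39) (t * 4 % 39) (t * 25 % 39) (t * 10 % 39)) &&
    !(perm3B (t * 1 % 39) (t * 16 % 39) (t * 22 % 39) (t * 8 % 39) (t * 11 % 39) (t * 20 % 39))) = true := by
  decide +kernel

/-! ## THEOREM U⁼ with its exceptions listed, at every odd level -/

/-- **THEOREM U⁼ WITH THE LIST OF EXCEPTIONS**: at every odd level `N`, two all-unit zero-sum triples with the same CM
type are equal as multisets of `ℤ/N` — unless `N = 21` and they are `{t, 4t, 16t}`, `{2t, 8t, 11t}`, or `N = 39` and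
they are `{t, 16t, 22t}` and one of `{2t, 32t, 5t}`, `{4t, 25t, 10t}`, `{8t, 11t, 20t}`, for some `t`. -/
def ThmUList : Prop :=
  ∀ N a b c a' b' c' : ℕ, ¬ 2 ∣ N →
    N ∣ a + b + c → N ∣ a' + b' + c' →
    Nat.Coprime a N → Nat.Coprime b N → Nat.Coprime c N →
    Nat.Coprime a' N → Nat.Coprime b' N → Nat.Coprime c' N →
    SameType N (a, b, c) (a', b', c') →
    ({(a : ZMod N), (b : ZMod N), (c : ZMod N)} : Multiset (ZMod N)) =
        {(a' : ZMod N), (b' : ZMod N), (c' : ZMod N)} ∨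
      (N = 21 ∧ ∃ t : ZMod 21,
        ({(a : ZMod 21), (b : ZMod 21), (c : ZMod 21)} : Multiset (ZMod 21)) = {t, 4 * t, 16 * t} ∧
        ({(a' : ZMod 21), (b' : ZMod 21), (c' : ZMod 21)} : Multiset (ZMod 21)) = {2 * t, 8 * t, 11 * t}) ∨
      (N = 39 ∧ ∃ t : ZMod 39,
        ({(a : ZMod 39), (b : ZMod 39), (c : ZMod 39)} : Multiset (ZMod 39)) = {t, 16 * t, 22 * t} ∧
        (({(a' : ZMod 39), (b' : ZMod 39), (c' : ZMod 39)} : Multiset (ZMod 39)) = {2 * t, 32 * t, 5 * t} ∨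
          ({(a' : ZMod 39), (b' : ZMod 39), (c' : ZMod 39)} : Multiset (ZMod 39)) = {4 * t, 25 * t, 10 * t} ∨
          ({(a' : ZMod 39), (b' : ZMod 39), (c' : ZMod 39)} : Multiset (ZMod 39)) = {8 * t, 11 * t, 20 * t}))

/-- THEOREM U⁼ with the list of exceptions, from THEOREM U⁼ (`ThmUEq`, odd `N ∉ {21, 39}`) and the enumerations at
`21` and `39`. -/
theorem thmUList_of (hU : ThmUEq) : ThmUList := by
  intro N a b c a' b' c' h2 hs hs' ha hb hc ha' hb' hc' hT
  by_cases h21 : N = 21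
  · subst h21
    rcases coincidences_21 a b c a' b' c' hs hs' ha hb hc ha' hb' hc' hT with h | h
    · exact Or.inl h
    · exact Or.inr (Or.inl ⟨rfl, h⟩)
  by_cases h39 : N = 39
  · subst h39
    rcases coincidences_39 a b c a' b' c' hs hs' ha hb hc ha' hb' hc' hT with h | h
    · exact Or.inl h
    · exact Or.inr (Or.inr ⟨rfl, h⟩)
  exact Or.inl (zmod_multiset_eq (hU N a b c a' b' c' h2 h21 h39 hs hs' ha hb hc ha' hb' hc' hT))

end HodgeFermat.KRFree.CoincEnum
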